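import Summits.Ventures.LatticeQCDFlow.Exactness.InvolutiveMetropolis
import HarnessLib

/-!
# Deterministic-proposal Metropolis preserves `e^{−H} μ` — integrated form, unbounded observables

HONEST FRAMING: exact (Metropolis-corrected) sampling algorithms for lattice gauge theory;
figures of merit are autocorrelation/cost numbers at stated couplings and volumes; no
continuum-physics claim.  (SCALAR calibration rung S0-A: not a gauge result.)

Venture `LatticeQCDFlow` (cell pub-lqcd), topic `Exactness`; FANOUT row 2 (`s0-phi4`: the HMC arm
of the 2D φ⁴ calibration).  NEW WORK of the cell over Mathlib; nothing is cited as a fact.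
Printed counterparts, named only: Tierney 1998 §2 (deterministic proposals), Mehlig–Heermann–
Forrest 1992 / Neal 1993 (HMC is exact for any volume-preserving reversible map).

Relation to the tree.  `Exactness/InvolutiveMetropolis.lean` (row 30, `involMH_invariant`) proves
the statement SET-WISE, as invariance of a Mathlib `Kernel`: a measurable `vol`-preserving
involution `Ψ`, Metropolis-corrected with `a = min(1, e^{H − H∘Ψ})` (`involAccept`), leaves
`e^{−H} vol` invariant.  This file is the same fact in the INTEGRATED form used by row 2's concrete
exactness files (`Phi4LocalMetropolisExact`, `Phi4IndependenceSamplerExact`, `Phi4HMCExact`):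
an identity of Bochner integrals over observables `g` with `g e^{−H}` integrable — unbounded
observables (moments `φ²`, `φ⁴`, two-point functions: the battery's columns) included.

## What is proved (measure space `(X, μ)`, measurable `H : X → ℝ`, `Ψ : X → X`)

* `involOp H Ψ g = a·(g ∘ Ψ) + (1 − a)·g` — the one-step operator on observables;
  `involAccept_nonneg`, `involAccept_le_one`, `measurable_involAccept`,
  `involAccept_mul_exp_neg_le` (`a e^{−H} ≤ e^{−H∘Ψ}`: the accepted mass is dominated by the
  weight at the proposal).
* **`integral_involAccept_comp`** — `Ψ` a measurable `μ`-preserving involution, ANY `g`: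
  `∫ a·(g∘Ψ)·e^{−H} dμ = ∫ a·g·e^{−H} dμ` (the symmetrised weight `min(e^{−H}, e^{−H∘Ψ})` is
  `Ψ`-invariant; substitution along the measurable equivalence `MeasurableEquiv.ofInvolutive Ψ`).
* `integrable_involAccept_comp_mul`, `integrable_involAccept_mul`, `integrable_involOp_mul` — the
  three pieces are integrable as soon as `g e^{−H}` is (the first by measure preservation).
* **`involOp_integral_invariant`** — `∫ (involOp H Ψ g) e^{−H} dμ = ∫ g e^{−H} dμ` for every
  measurable `g` with `g e^{−H}` integrable.  HMC is the instance `X` = phase space, `μ` =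
  Lebesgue, `Ψ` = flip ∘ leapfrog^N (`Exactness/Phi4HMCExact.lean`).

NOT CLAIMED: anything about rates; `H` need not be bounded below (no integrability of `e^{−H}`
itself is assumed — only of `g e^{−H}`).
-/

namespace Summit.Ventures.LatticeQCDFlow.Exactness

open Real MeasureTheory Filter

/-! ## §1 Deterministic-proposal Metropolis, integrated form -/

section General

variable {X : Type*} [MeasurableSpace X] {μ : Measure X}

/-- The one-step operator of the deterministic-proposal Metropolis kernel on observables:
`(involOp H Ψ g)(z) = a(z) g(Ψ z) + (1 − a(z)) g(z)`, `a = min(1, e^{H z − H (Ψ z)})`. -/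
noncomputable def involOp (H : X → ℝ) (Ψ : X → X) (g : X → ℝ) (z : X) : ℝ :=
  involAccept H Ψ z * g (Ψ z) + (1 - involAccept H Ψ z) * g z

omit [MeasurableSpace X] in
/-- The acceptance probability is nonnegative. -/
theorem involAccept_nonneg (H : X → ℝ) (Ψ : X → X) (z : X) : 0 ≤ involAccept H Ψ z :=
  le_min zero_le_one (Real.exp_pos _).le

omit [MeasurableSpace X] in
/-- The acceptance probability is at most one. -/
theorem involAccept_le_one (H : X → ℝ) (Ψ : X → X) (z : X) : involAccept H Ψ z ≤ 1 :=
  min_le_left _ _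

/-- Measurability of the (real-valued) acceptance probability. -/
theorem measurable_involAccept {H : X → ℝ} {Ψ : X → X} (hH : Measurable H) (hΨ : Measurable Ψ) :
    Measurable (involAccept H Ψ) := by
  unfold involAccept
  exact measurable_const.min (Real.measurable_exp.comp (hH.sub (hH.comp hΨ)))

omit [MeasurableSpace X] in
/-- The accepted mass is dominated by the weight AT THE PROPOSAL:
`a(z) e^{−H z} ≤ e^{−H (Ψ z)}` (it is `min(e^{−H z}, e^{−H (Ψ z)})`). -/
theorem involAccept_mul_exp_neg_le (H : X → ℝ) (Ψ : X → X) (z : X) :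
    involAccept H Ψ z * Real.exp (-H z) ≤ Real.exp (-H (Ψ z)) := by
  rw [mul_comm, exp_neg_mul_involAccept]
  exact min_le_right _ _

/-- **The move part of detailed balance, integrated**: for a measurable `μ`-preserving involution
`Ψ`, every measurable `H` and EVERY measurable `g`,
`∫ a(z) g(Ψ z) e^{−H z} dμ = ∫ a(z) g(z) e^{−H z} dμ`. -/
theorem integral_involAccept_comp {H : X → ℝ} {Ψ : X → X} (hΨm : Measurable Ψ)
    (hΨi : Function.Involutive Ψ) (hΨμ : MeasurePreserving Ψ μ μ) (g : X → ℝ) :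
    ∫ z, involAccept H Ψ z * g (Ψ z) * Real.exp (-H z) ∂μ
      = ∫ z, involAccept H Ψ z * g z * Real.exp (-H z) ∂μ := by
  -- the symmetrised weight
  set m : X → ℝ := fun z => min (Real.exp (-H z)) (Real.exp (-H (Ψ z))) with hm
  have hmΨ : ∀ z, m (Ψ z) = m z := fun z => by
    simp only [hm, hΨi z, min_comm]
  have h1 : ∀ z, involAccept H Ψ z * g (Ψ z) * Real.exp (-H z) = (fun y => m y * g y) (Ψ z) := by
    intro z
    show _ = m (Ψ z) * g (Ψ z)
    rw [hmΨ z]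
    simp only [hm]
    rw [← exp_neg_mul_involAccept]
    ring
  have h2 : ∀ z, involAccept H Ψ z * g z * Real.exp (-H z) = m z * g z := by
    intro z
    simp only [hm]
    rw [← exp_neg_mul_involAccept]
    ring
  simp_rw [h1, h2]
  exact hΨμ.integral_comp (MeasurableEquiv.ofInvolutive Ψ hΨi hΨm).measurableEmbedding
    (fun y => m y * g y)

/-- The accepted term is integrable as soon as `g e^{−H}` is. -/
theorem integrable_involAccept_comp_mul {H : X → ℝ} {Ψ : X → X} (hH : Measurable H)
    (hΨm : Measurable Ψ) (hΨμ : MeasurePreserving Ψ μ μ) {g : X → ℝ}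
    (hgm : Measurable g) (hgw : Integrable (fun z => g z * Real.exp (-H z)) μ) :
    Integrable (fun z => involAccept H Ψ z * g (Ψ z) * Real.exp (-H z)) μ := by
  have hcomp : Integrable (fun z => g (Ψ z) * Real.exp (-H (Ψ z))) μ :=
    (hΨμ.integrable_comp hgw.aestronglyMeasurable).mpr hgw
  refine Integrable.mono' hcomp.norm
    (((measurable_involAccept hH hΨm).mul (hgm.comp hΨm)).mul
      (Real.measurable_exp.comp hH.neg)).aestronglyMeasurable (Eventually.of_forall fun z => ?_)
  rw [Real.norm_eq_abs, Real.norm_eq_abs, abs_mul, abs_mul, abs_mul,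
    abs_of_nonneg (involAccept_nonneg H Ψ z), abs_of_pos (Real.exp_pos _),
    abs_of_pos (Real.exp_pos _)]
  calc involAccept H Ψ z * |g (Ψ z)| * Real.exp (-H z)
      = |g (Ψ z)| * (involAccept H Ψ z * Real.exp (-H z)) := by ring
    _ ≤ |g (Ψ z)| * Real.exp (-H (Ψ z)) :=
        mul_le_mul_of_nonneg_left (involAccept_mul_exp_neg_le H Ψ z) (abs_nonneg _)

/-- The `a·g·e^{−H}` term is integrable as soon as `g e^{−H}` is. -/
theorem integrable_involAccept_mul {H : X → ℝ} {Ψ : X → X} (hH : Measurable H)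
    (hΨm : Measurable Ψ) {g : X → ℝ} (hgm : Measurable g)
    (hgw : Integrable (fun z => g z * Real.exp (-H z)) μ) :
    Integrable (fun z => involAccept H Ψ z * g z * Real.exp (-H z)) μ := by
  refine Integrable.mono' hgw.norm
    (((measurable_involAccept hH hΨm).mul hgm).mul
      (Real.measurable_exp.comp hH.neg)).aestronglyMeasurable (Eventually.of_forall fun z => ?_)
  rw [Real.norm_eq_abs, Real.norm_eq_abs, abs_mul, abs_mul, abs_mul,
    abs_of_nonneg (involAccept_nonneg H Ψ z), abs_of_pos (Real.exp_pos _)]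
  calc involAccept H Ψ z * |g z| * Real.exp (-H z)
      ≤ 1 * |g z| * Real.exp (-H z) := by
        gcongr
        exact involAccept_le_one H Ψ z
    _ = |g z| * Real.exp (-H z) := by ring

/-- `(involOp g) e^{−H}` is integrable as soon as `g e^{−H}` is. -/
theorem integrable_involOp_mul {H : X → ℝ} {Ψ : X → X} (hH : Measurable H)
    (hΨm : Measurable Ψ) (hΨμ : MeasurePreserving Ψ μ μ) {g : X → ℝ}
    (hgm : Measurable g) (hgw : Integrable (fun z => g z * Real.exp (-H z)) μ) :
    Integrable (fun z => involOp H Ψ g z * Real.exp (-H z)) μ := by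
  have h1 := integrable_involAccept_comp_mul hH hΨm hΨμ hgm hgw
  have h2 := integrable_involAccept_mul hH hΨm hgm hgw
  refine ((h1.add hgw).sub h2).congr (Eventually.of_forall fun z => ?_)
  simp only [involOp, Pi.add_apply, Pi.sub_apply]
  ring

/-- **Deterministic-proposal Metropolis preserves `e^{−H} μ` — integrated form.**  For a
measurable `μ`-preserving involution `Ψ`, a measurable `H`, and every measurable observable `g`
with `g e^{−H}` integrable: `∫ (involOp H Ψ g) e^{−H} dμ = ∫ g e^{−H} dμ`. -/
theorem involOp_integral_invariant {H : X → ℝ} {Ψ : X → X} (hH : Measurable H)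
    (hΨm : Measurable Ψ) (hΨi : Function.Involutive Ψ) (hΨμ : MeasurePreserving Ψ μ μ)
    {g : X → ℝ} (hgm : Measurable g) (hgw : Integrable (fun z => g z * Real.exp (-H z)) μ) :
    ∫ z, involOp H Ψ g z * Real.exp (-H z) ∂μ = ∫ z, g z * Real.exp (-H z) ∂μ := by
  have h1 := integrable_involAccept_comp_mul hH hΨm hΨμ hgm hgw
  have h2 := integrable_involAccept_mul hH hΨm hgm hgw
  have hsplit : ∀ z, involOp H Ψ g z * Real.exp (-H z)
      = involAccept H Ψ z * g (Ψ z) * Real.exp (-H z)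
        + (g z * Real.exp (-H z) - involAccept H Ψ z * g z * Real.exp (-H z)) := by
    intro z
    simp only [involOp]
    ring
  have h3 : Integrable (fun z => g z * Real.exp (-H z) - involAccept H Ψ z * g z * Real.exp (-H z)) μ :=
    hgw.sub h2
  simp_rw [hsplit]
  rw [integral_add h1 h3, integral_sub hgw h2, integral_involAccept_comp hΨm hΨi hΨμ g]
  ring

end General

end Summit.Ventures.LatticeQCDFlow.Exactness
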